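import Mathlib
import Summits.Ventures.PercRepro2.TypedBasesStar

/-!
# (TRI-oM): the typed bases of row 2′TRI conditioned on the colouring of the typed edges between
`o` and the MARKS (blind cell PercRepro2, night-3 g15, 2026-08-27; `proofs/NIGHT3-CERT.md` §24.10)

`TypedBasesStar.lean` (typer-1 g44) holds the statement (TRI-o) — every class sum of the symmetrised
kernel with the whole `o`-star colouring fixed is nonnegative — which is FALSE at nine typed edges
(NEG-191: the negative classes all fix an edge from `o` to an UNMARKED hub). The candidate that
survives the seat's censuses fixes only the typed edges from `o` to a marked vertex `a₁, a₂, a₃, b`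
(`markStar`): every abstract instance with ≤ 7 typed edges (1,519,134,398 instances, every class),
the `|F| = 8` and `|F| = 9` domains of record (5,987,328 + 65,491,456 class tests) and a random
residual-like sweep at 10–12 typed edges — 0 negative classes. NOT claimed proved; one seat, one code.

* **`markStar`**: the typed edges joining `o` to one of `a₁, a₂, a₃, b`;
* **`TypedBasesOM`**: the statement (TRI-oM);
* **`TypedBases_of_typedBasesOM`**: (TRI-oM) ⟹ row 2′TRI (the class partition
  `typedCount_eq_sum_typedClassCount` of `TypedBasesStar` with `S = markStar`, then
  `typedCount_symKer`).
Nothing here asserts anything about the original lane.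
-/

namespace Summit.Ventures.PercRepro2

namespace CovForm

namespace TriOM

section Statement

variable {V : Type*} {E : Type*} [Fintype E] [DecidableEq E] [DecidableEq V]
  {R : Type*} [Field R] [LinearOrder R] [IsStrictOrderedRing R]

/-- The typed edges joining `o` to a marked vertex. -/
def markStar (ends : E → Sym2 V) (o a₁ a₂ a₃ b : V) (F : Finset E) : Finset E :=
  F.filter fun e => o ∈ ends e ∧ (a₁ ∈ ends e ∨ a₂ ∈ ends e ∨ a₃ ∈ ends e ∨ b ∈ ends e)

/-- **(TRI-oM)**: every class sum of the symmetrised kernel with the colouring of the typed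
`o`–mark edges fixed is nonnegative — CANDIDATE (census-clean at ≤ 7 typed edges on every graph
and on the `|F| = 8, 9` domains of record; `NIGHT3-CERT.md` §24.10); NOT claimed proved. -/
def TypedBasesOM (ends : E → Sym2 V) (o a₁ a₂ a₃ b : V) : Prop :=
  ∀ (F : Finset E) (z : Config E) (τ : E → ℕ), (∀ e ∈ F, τ e = 1 ∨ τ e = 2) →
    ∀ x₀ y₀ w₀ : Config E,
      0 ≤ typedClassCount F z τ (markStar ends o a₁ a₂ a₃ b F) x₀ y₀ w₀
        (symKer (K3 ends o a₁ a₂ a₃ b : Config E → Config E → Config E → R))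

/-- **(TRI-oM) strengthens row 2′TRI** (sum the classes, drop the symmetrisation). -/
theorem TypedBases_of_typedBasesOM (ends : E → Sym2 V) (o a₁ a₂ a₃ b : V)
    (h : TypedBasesOM (R := R) ends o a₁ a₂ a₃ b) : TypedBases (R := R) ends o a₁ a₂ a₃ b := by
  intro F z τ hτ
  rw [← typedCount_symKer F z τ hτ,
    typedCount_eq_sum_typedClassCount F z τ (markStar ends o a₁ a₂ a₃ b F)]
  refine Finset.sum_nonneg fun x₀ _ => Finset.sum_nonneg fun y₀ _ =>
    Finset.sum_nonneg fun w₀ _ => ?_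
  split_ifs
  · exact h F z τ hτ x₀ y₀ w₀
  · exact le_rfl

end Statement

end TriOM

end CovForm

end Summit.Ventures.PercRepro2
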